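import Mathlib
import Summits.ResolutionOfSingularities.ResolutionOfSingularities.Theorems.HomologicalConductorPersistenceKC3LocalModelEquiv
import HarnessLib

/-!
# Crux `Persistence` (stmt-ResolutionOfSingularities-16484) — w44b K-C3, K2c (c1) corollaries AT THE ROUTE'S LITERAL `T₀ = loc O A`:
# `x ∈ ca (loc O A)` (K1) and `ca (loc O A) ⊆ (x, y, z², zt, t²)·(loc O A)` (K2-upper), fact-free

Route `ResolutionOfSingularities/HomologicalConductor`, chain W4.4b (cell `res-hironaka`), crux `Persistence`
(stmt-ResolutionOfSingularities-16484), KILL CANDIDATE K-C3, KC3 SPELLING v1.1; res-L1-w44b-plan-1 RE-CUT 2026-08-27T12:34:43Z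
(«K2c (c0)+(c1) → res-type-010 … land the two consumed corollaries as theorems»). Setting as in `…KC3LocalModelEquiv`: `K` a
fraction field of `k[x,z,t]`, `x, z, t` the images of `X 0, X 1, X 2`, `y = (z³+t⁴)·x⁻¹`, `A = Algebra.adjoin k {x, z, t, y}`, `O` a
valuation ring of `K` containing `k` with `x, y, z, t` in its maximal ideal (084's monomial valuation ring qualifies), `T₀ = loc O A`,
`ca` = the route's set-valued cohomology annihilator `NoZeno.Birth.ca`.

* **`kc3_x_mem_ca_loc`** — `x ∈ ca (loc O A)`: affine K1 (res-D-pv-058 p522421) → local (p530376) → `T₀` along `exists_kc3LocModelEquiv`;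
* **`kc3_ca_loc_subset`** — `ca (loc O A) ⊆ {α x + β y + γ z² + δ zt + ε t² | α, …, ε ∈ loc O A}` — res-D-pv-043's `hca` `⊆`-half
  (`PersistenceKC3TowerInstance.kc3_tower_one_eq`, p528915) — from §6 `cohomologyAnnihilatorOfDegree_le_map_I_local` (p530376).
Both unconditional (no printed input), every field `k`. res-type-010. OURS; nothing here is a statement of the manuscript under review
(Hironaka 2017); AI-written, weaker than expert review. Filed `--supports stmt-ResolutionOfSingularities-16484 --as helper`.
-/

noncomputable section

-- single-problem summit: the doubled namespace component `ResolutionOfSingularities` is forced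
set_option linter.dupNamespace false

namespace Summit.ResolutionOfSingularities.ResolutionOfSingularities.Theorems.HomologicalConductor.KC3Upper

open MvPolynomial
open Literature.RingTheory.CohomologyAnnihilator
open Literature.AlgebraicGeometry.Resolution
open Summit.ResolutionOfSingularities.ResolutionOfSingularities.Theorems.NoZeno.Birth
open Summit.ResolutionOfSingularities.ResolutionOfSingularities.Theorems.HomologicalConductor.PersistenceKC3Tower

section KC3

variable (k K : Type) [Field k] [Field K] [Algebra (MvPolynomial (Fin 3) k) K] [IsFractionRing (MvPolynomial (Fin 3) k) K]
  [Algebra k K] [IsScalarTower k (MvPolynomial (Fin 3) k) K]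

/-- `W ≤ loc O W` (`a = a · 1⁻¹`). [folklore] -/
theorem mem_loc_of_mem {k K : Type} [Field k] [Field K] [Algebra k K] (O : ValuationSubring K) (W : Subalgebra k K)
    {a : K} (ha : a ∈ W) : a ∈ loc O W :=
  (mem_loc_iff O W).mpr ⟨a, ha, 1, W.one_mem, by rw [inv_one]; exact O.one_mem, by rw [inv_one, mul_one]⟩

/-- **K1 AT THE ROUTE'S `T₀` (OURS · w44b K5 glue): `x ∈ ca (loc O A)`** — the route's set-valued cohomology annihilator
(`NoZeno.Birth.ca`) of `T₀ = loc O A` contains `x`, for every valuation ring `O ∋ k` centred at the origin of `A`. Fact-free: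
affine K1 (res-D-pv-058 p522421) → local (p530376 `mk_algebraMap_mem_cohomologyAnnihilatorOfDegree_four_local`) → `T₀` along
`exists_kc3LocModelEquiv`. [OURS · L1 w44b] -/
theorem kc3_x_mem_ca_loc (O : ValuationSubring K) (hk : ∀ c : k, algebraMap k K c ∈ O)
    (hx : O.valuation (algebraMap (MvPolynomial (Fin 3) k) K (X 0)) < 1)
    (hy : O.valuation ((algebraMap (MvPolynomial (Fin 3) k) K (X 1) ^ 3 + algebraMap (MvPolynomial (Fin 3) k) K (X 2) ^ 4) *
      (algebraMap (MvPolynomial (Fin 3) k) K (X 0))⁻¹) < 1)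
    (hz : O.valuation (algebraMap (MvPolynomial (Fin 3) k) K (X 1)) < 1)
    (ht : O.valuation (algebraMap (MvPolynomial (Fin 3) k) K (X 2)) < 1) :
    algebraMap (MvPolynomial (Fin 3) k) K (X 0) ∈
      NoZeno.Birth.ca (loc O (Algebra.adjoin k ({algebraMap (MvPolynomial (Fin 3) k) K (X 0), algebraMap (MvPolynomial (Fin 3) k) K (X 1),
        algebraMap (MvPolynomial (Fin 3) k) K (X 2),
        (algebraMap (MvPolynomial (Fin 3) k) K (X 1) ^ 3 + algebraMap (MvPolynomial (Fin 3) k) K (X 2) ^ 4) *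
          (algebraMap (MvPolynomial (Fin 3) k) K (X 0))⁻¹} : Set K))) := by
  set A : Subalgebra k K := Algebra.adjoin k ({algebraMap (MvPolynomial (Fin 3) k) K (X 0),
      algebraMap (MvPolynomial (Fin 3) k) K (X 1), algebraMap (MvPolynomial (Fin 3) k) K (X 2),
      (algebraMap (MvPolynomial (Fin 3) k) K (X 1) ^ 3 + algebraMap (MvPolynomial (Fin 3) k) K (X 2) ^ 4) *
        (algebraMap (MvPolynomial (Fin 3) k) K (X 0))⁻¹} : Set K) with hA
  obtain ⟨e, he⟩ := exists_kc3LocModelEquiv k K O hk hx hy hz ht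
  have hxA : algebraMap (MvPolynomial (Fin 3) k) K (X 0) ∈ A := Algebra.subset_adjoin (by simp)
  have hxT := mem_loc_of_mem O A hxA
  -- `x = φ₀ (X 0)`
  have hφx : MvPolynomial.aeval (R := k)
      (![algebraMap (MvPolynomial (Fin 3) k) K (X 0),
        (algebraMap (MvPolynomial (Fin 3) k) K (X 1) ^ 3 + algebraMap (MvPolynomial (Fin 3) k) K (X 2) ^ 4) *
          (algebraMap (MvPolynomial (Fin 3) k) K (X 0))⁻¹,
        algebraMap (MvPolynomial (Fin 3) k) K (X 1), algebraMap (MvPolynomial (Fin 3) k) K (X 2)] : Fin 4 → K) (X 0) =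
      algebraMap (MvPolynomial (Fin 3) k) K (X 0) := by simp
  have hxT' : MvPolynomial.aeval (R := k)
      (![algebraMap (MvPolynomial (Fin 3) k) K (X 0),
        (algebraMap (MvPolynomial (Fin 3) k) K (X 1) ^ 3 + algebraMap (MvPolynomial (Fin 3) k) K (X 2) ^ 4) *
          (algebraMap (MvPolynomial (Fin 3) k) K (X 0))⁻¹,
        algebraMap (MvPolynomial (Fin 3) k) K (X 1), algebraMap (MvPolynomial (Fin 3) k) K (X 2)] : Fin 4 → K) (X 0) ∈
      loc O A := by
    rw [hφx]; exact hxT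
  have hex : e ⟨algebraMap (MvPolynomial (Fin 3) k) K (X 0), hxT⟩ =
      Ideal.Quotient.mk _ (algebraMap (MvPolynomial (Fin 4) k) (Localization.AtPrime (originIdeal k 4)) (X 0)) := by
    rw [← he (X 0) hxT']
    congr 1
    exact Subtype.ext hφx.symm
  -- `x̄ ∈ ca⁴(model)` (K1 local), transported back along `e.symm`
  have hmodel := mk_algebraMap_mem_cohomologyAnnihilatorOfDegree_four_local k (b := X 0) (Ideal.subset_span (by simp))
  have h4 := ringEquiv_apply_mem_cohomologyAnnihilatorOfDegree (S := ↥(loc O A)) e.symm hmodel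
  have hsymm : e.symm (Ideal.Quotient.mk _
      (algebraMap (MvPolynomial (Fin 4) k) (Localization.AtPrime (originIdeal k 4)) (X 0))) =
      ⟨algebraMap (MvPolynomial (Fin 3) k) K (X 0), hxT⟩ := by
    rw [RingEquiv.symm_apply_eq, hex]
  rw [hsymm] at h4
  have hu : (⟨algebraMap (MvPolynomial (Fin 3) k) K (X 0), hxT⟩ : ↥(loc O A)) ∈ cohomologyAnnihilator ↥(loc O A) :=
    SetLike.le_def.mp (cohomologyAnnihilatorOfDegree_le (R := ↥(loc O A)) 4) h4
  have hb := Subalgebra.image_coe_cohomologyAnnihilator (loc O A)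
  have hmem : algebraMap (MvPolynomial (Fin 3) k) K (X 0) ∈
      ((↑) : ↥(loc O A) → K) '' (cohomologyAnnihilator ↥(loc O A) : Set ↥(loc O A)) := ⟨_, hu, rfl⟩
  rw [hb] at hmem
  exact hmem

/-- **K2-UPPER AT THE ROUTE'S `T₀` (OURS · w44b K5 glue): `ca (loc O A) ⊆ I·(loc O A)`** in res-D-pv-043's `hca` shape
(`kc3_tower_one_eq`, p528915): every element of the route's set-valued cohomology annihilator of `T₀ = loc O A` is
`α x + β y + γ z² + δ zt + ε t²` with `α, …, ε ∈ loc O A` (`y = (z³+t⁴)·x⁻¹`). Fact-free, every field `k`, every valuation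
ring `O ∋ k` centred at the origin of `A`: §6 (`cohomologyAnnihilatorOfDegree_le_map_I_local`, p530376) transported along
`exists_kc3LocModelEquiv`. (The `⊇` half is res-type-011's K2-LOWER, modulo the Esentepe facts.) [OURS · L1 w44b] -/
theorem kc3_ca_loc_subset (O : ValuationSubring K) (hk : ∀ c : k, algebraMap k K c ∈ O)
    (hx : O.valuation (algebraMap (MvPolynomial (Fin 3) k) K (X 0)) < 1)
    (hy : O.valuation ((algebraMap (MvPolynomial (Fin 3) k) K (X 1) ^ 3 + algebraMap (MvPolynomial (Fin 3) k) K (X 2) ^ 4) *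
      (algebraMap (MvPolynomial (Fin 3) k) K (X 0))⁻¹) < 1)
    (hz : O.valuation (algebraMap (MvPolynomial (Fin 3) k) K (X 1)) < 1)
    (ht : O.valuation (algebraMap (MvPolynomial (Fin 3) k) K (X 2)) < 1) :
    NoZeno.Birth.ca (loc O (Algebra.adjoin k ({algebraMap (MvPolynomial (Fin 3) k) K (X 0),
        algebraMap (MvPolynomial (Fin 3) k) K (X 1), algebraMap (MvPolynomial (Fin 3) k) K (X 2),
        (algebraMap (MvPolynomial (Fin 3) k) K (X 1) ^ 3 + algebraMap (MvPolynomial (Fin 3) k) K (X 2) ^ 4) *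
          (algebraMap (MvPolynomial (Fin 3) k) K (X 0))⁻¹} : Set K))) ⊆
      {c : K | ∃ α β γ δ ε : K,
        α ∈ loc O (Algebra.adjoin k ({algebraMap (MvPolynomial (Fin 3) k) K (X 0),
          algebraMap (MvPolynomial (Fin 3) k) K (X 1), algebraMap (MvPolynomial (Fin 3) k) K (X 2),
          (algebraMap (MvPolynomial (Fin 3) k) K (X 1) ^ 3 + algebraMap (MvPolynomial (Fin 3) k) K (X 2) ^ 4) *
            (algebraMap (MvPolynomial (Fin 3) k) K (X 0))⁻¹} : Set K)) ∧
        β ∈ loc O (Algebra.adjoin k ({algebraMap (MvPolynomial (Fin 3) k) K (X 0),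
          algebraMap (MvPolynomial (Fin 3) k) K (X 1), algebraMap (MvPolynomial (Fin 3) k) K (X 2),
          (algebraMap (MvPolynomial (Fin 3) k) K (X 1) ^ 3 + algebraMap (MvPolynomial (Fin 3) k) K (X 2) ^ 4) *
            (algebraMap (MvPolynomial (Fin 3) k) K (X 0))⁻¹} : Set K)) ∧
        γ ∈ loc O (Algebra.adjoin k ({algebraMap (MvPolynomial (Fin 3) k) K (X 0),
          algebraMap (MvPolynomial (Fin 3) k) K (X 1), algebraMap (MvPolynomial (Fin 3) k) K (X 2),
          (algebraMap (MvPolynomial (Fin 3) k) K (X 1) ^ 3 + algebraMap (MvPolynomial (Fin 3) k) K (X 2) ^ 4) *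
            (algebraMap (MvPolynomial (Fin 3) k) K (X 0))⁻¹} : Set K)) ∧
        δ ∈ loc O (Algebra.adjoin k ({algebraMap (MvPolynomial (Fin 3) k) K (X 0),
          algebraMap (MvPolynomial (Fin 3) k) K (X 1), algebraMap (MvPolynomial (Fin 3) k) K (X 2),
          (algebraMap (MvPolynomial (Fin 3) k) K (X 1) ^ 3 + algebraMap (MvPolynomial (Fin 3) k) K (X 2) ^ 4) *
            (algebraMap (MvPolynomial (Fin 3) k) K (X 0))⁻¹} : Set K)) ∧
        ε ∈ loc O (Algebra.adjoin k ({algebraMap (MvPolynomial (Fin 3) k) K (X 0),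
          algebraMap (MvPolynomial (Fin 3) k) K (X 1), algebraMap (MvPolynomial (Fin 3) k) K (X 2),
          (algebraMap (MvPolynomial (Fin 3) k) K (X 1) ^ 3 + algebraMap (MvPolynomial (Fin 3) k) K (X 2) ^ 4) *
            (algebraMap (MvPolynomial (Fin 3) k) K (X 0))⁻¹} : Set K)) ∧
        c = α * algebraMap (MvPolynomial (Fin 3) k) K (X 0) +
          β * ((algebraMap (MvPolynomial (Fin 3) k) K (X 1) ^ 3 + algebraMap (MvPolynomial (Fin 3) k) K (X 2) ^ 4) *
            (algebraMap (MvPolynomial (Fin 3) k) K (X 0))⁻¹) +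
          γ * algebraMap (MvPolynomial (Fin 3) k) K (X 1) ^ 2 +
          δ * (algebraMap (MvPolynomial (Fin 3) k) K (X 1) * algebraMap (MvPolynomial (Fin 3) k) K (X 2)) +
          ε * algebraMap (MvPolynomial (Fin 3) k) K (X 2) ^ 2} := by
  set x : K := algebraMap (MvPolynomial (Fin 3) k) K (X 0) with hxdef
  set z : K := algebraMap (MvPolynomial (Fin 3) k) K (X 1) with hzdef
  set t : K := algebraMap (MvPolynomial (Fin 3) k) K (X 2) with htdef
  set A : Subalgebra k K := Algebra.adjoin k ({x, z, t, (z ^ 3 + t ^ 4) * x⁻¹} : Set K) with hA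
  set g : Fin 4 → K := ![x, (z ^ 3 + t ^ 4) * x⁻¹, z, t] with hgdef
  set S := Localization.AtPrime (originIdeal k 4)
  obtain ⟨e, he⟩ := exists_kc3LocModelEquiv k K O hk hx hy hz ht
  -- every `φ₀ p` lies in `T = loc O A`, and `e.symm` takes `(p/1)‾` back to it
  have hφT : ∀ p : MvPolynomial (Fin 4) k, MvPolynomial.aeval (R := k) g p ∈ loc O A := fun p =>
    mem_loc_of_mem O A (by rw [hA, hxdef, hzdef, htdef, ← range_aeval_kc3 k K]; exact ⟨p, rfl⟩)
  have hback : ∀ p : MvPolynomial (Fin 4) k,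
      e.symm (Ideal.Quotient.mk _ (algebraMap (MvPolynomial (Fin 4) k) S p)) = ⟨MvPolynomial.aeval (R := k) g p, hφT p⟩ :=
    fun p => by rw [RingEquiv.symm_apply_eq, he p (hφT p)]
  intro c hc
  -- `c = ↑u` with `u ∈ caᵐ(↥T)` for some `m`
  have hb := Subalgebra.image_coe_cohomologyAnnihilator (loc O A)
  have hc' : c ∈ ((↑) : ↥(loc O A) → K) '' (cohomologyAnnihilator ↥(loc O A) : Set ↥(loc O A)) := by
    rw [hb]; exact hc
  obtain ⟨u, hu, rfl⟩ := hc'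
  rw [SetLike.mem_coe, mem_cohomologyAnnihilator_iff] at hu
  obtain ⟨m, hum⟩ := hu
  -- transport to the model and apply §6
  have h1 := ringEquiv_apply_mem_cohomologyAnnihilatorOfDegree (S := S ⧸ Ideal.span {algebraMap (MvPolynomial (Fin 4) k) S
    (X 0 * X 1 - X 2 ^ 3 - X 3 ^ 4)}) e hum
  have h2 := cohomologyAnnihilatorOfDegree_le_map_I_local k (originIdeal k 4) rfl m h1
  simp only [Ideal.map_span, Set.image_insert_eq, Set.image_singleton] at h2
  obtain ⟨r₀, w₁, hw₁, hr⟩ := Ideal.mem_span_insert.mp h2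
  obtain ⟨r₁, w₂, hw₂, rfl⟩ := Ideal.mem_span_insert.mp hw₁
  obtain ⟨r₂, w₃, hw₃, rfl⟩ := Ideal.mem_span_insert.mp hw₂
  obtain ⟨r₃, w₄, hw₄, rfl⟩ := Ideal.mem_span_insert.mp hw₃
  obtain ⟨r₄, rfl⟩ := Ideal.mem_span_singleton'.mp hw₄
  -- the four generators as elements of `T = loc O A`
  have hxA : x ∈ A := Algebra.subset_adjoin (by simp)
  have hzA : z ∈ A := Algebra.subset_adjoin (by simp)
  have htA : t ∈ A := Algebra.subset_adjoin (by simp)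
  have hyA : (z ^ 3 + t ^ 4) * x⁻¹ ∈ A := Algebra.subset_adjoin (by simp)
  have hb0 : e.symm (Ideal.Quotient.mk _ (algebraMap (MvPolynomial (Fin 4) k) S (X 0))) = ⟨x, mem_loc_of_mem O A hxA⟩ :=
    (hback (X 0)).trans (Subtype.ext (by simp [hgdef]))
  have hb1 : e.symm (Ideal.Quotient.mk _ (algebraMap (MvPolynomial (Fin 4) k) S (X 1))) =
      ⟨(z ^ 3 + t ^ 4) * x⁻¹, mem_loc_of_mem O A hyA⟩ :=
    (hback (X 1)).trans (Subtype.ext (by simp [hgdef]))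
  have hb2 : e.symm (Ideal.Quotient.mk _ (algebraMap (MvPolynomial (Fin 4) k) S (X 2))) = ⟨z, mem_loc_of_mem O A hzA⟩ :=
    (hback (X 2)).trans (Subtype.ext (by simp [hgdef]))
  have hb3 : e.symm (Ideal.Quotient.mk _ (algebraMap (MvPolynomial (Fin 4) k) S (X 3))) = ⟨t, mem_loc_of_mem O A htA⟩ :=
    (hback (X 3)).trans (Subtype.ext (by simp [hgdef]))
  -- back along `e.symm`
  have hu' := congrArg e.symm hr
  simp only [RingEquiv.symm_apply_apply, map_add, map_mul, map_pow] at hu'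
  rw [hb0, hb1, hb2, hb3] at hu'
  refine ⟨(e.symm r₀ : K), (e.symm r₁ : K), (e.symm r₂ : K), (e.symm r₃ : K), (e.symm r₄ : K), (e.symm r₀).2, (e.symm r₁).2,
    (e.symm r₂).2, (e.symm r₃).2, (e.symm r₄).2, ?_⟩
  have hcoe := congrArg Subtype.val hu'
  simp only [Subalgebra.coe_add, Subalgebra.coe_mul, Subalgebra.coe_pow] at hcoe
  rw [hcoe]
  ring

end KC3

end Summit.ResolutionOfSingularities.ResolutionOfSingularities.Theorems.HomologicalConductor.KC3Upper

end
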